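import Summits.BirchSwinnertonDyer.BirchSwinnertonDyer.Theses.PrintCf2
import Summits.BirchSwinnertonDyer.BirchSwinnertonDyer.Theorems.PrintCf2RamifiedCongruentPartner
import HarnessLib

/-!
# Route `PrintCf2`, ramified type: the CLOSED part (item 20508, the TYZ families) is ISOGENY-SATURATED —
# granted `𝔅_ram`, every globally minimal curve `ℚ`-isogenous to a member of `CongruentTYZProvedFamily`
# satisfies `BSD(E,2)`; in particular both `j = 287496` partners `32a3^{(±n)}` and the `j = 1728`
# partner `y² = x³ + 4n²x` of every proved `E_n` (cell `bsd-print-cf2`, seat p4; serves the residual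
# item 20509 `RamifiedOffTYZOfFacts`)

HONEST FRAMING (cell `bsd-print-cf2`, D-0131 (2) print tier, PARTITION currency): item 20508
(`RamifiedTYZFamiliesOfFacts`: granted `𝔅_ram`, `BSD(E,2)` on the globally minimal CM rank-one curves
that are ℚ-MODELS of a member `E_n` of the flag-free Tian–Yuan–Zhang / Li–Liu–Tian / Tian / Monsky
families) is CLOSED (p1, `ramifiedTYZFamiliesOfFacts_proof`); the residual item 20509 is «off those
families». Membership there is up to ℚ-ISOMORPHISM; this file widens the closed part to ℚ-ISOGENY
classes, by name, with 20508 as a HYPOTHESIS `hT` (discharged in the tree) so that no route cone is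
joined:

* `bsdp_two_of_isIsogenous_tyzProved` — granted `𝔅_ram` and `hT`: a globally minimal `W` of analytic
  rank one that is `ℚ`-isogenous to some globally minimal `W₀ ∈ CongruentTYZProvedFamily` satisfies
  `BSD(W,2)` (`W₀` has CM with `2` ramified by p1's membership lemma; `r_an(W₀) = r_an(W)` by Faltings;
  `BSD(W₀,2)` by 20508; Cassels transport back, GZK + modularity from `𝔅_ram`).
* `ramifiedOffTYZ_isogenySaturated` — hence the part of 20509 consisting of curves isogenous to a
  proved-family member is closed: the TRUE residual of the ramified type is «isogeny classes with
  `j ∈ {1728, 287496}` containing NO proved `E_n`» ∪ «`j = 8000`».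
* `bsdp_two_of_j287496_of_partner_tyzProved` — the `j = 287496` instance through the explicit partner
  of `PrintCf2RamifiedCongruentPartner` (p542724): a globally minimal `j = 287496` curve of analytic
  rank one whose congruent partner `E_n` (n squarefree) is a member of the proved families satisfies
  `BSD(·,2)`. E.g. for `n ≡ 5 (mod 8)` with all prime factors `≡ 1 (mod 4)` and no class of order
  `4` in `Cl(ℚ(√−n))` (Li–Liu–Tian 2024 Thm 1.2), BOTH `j = 287496` twists `[0,−6,0,1,0]^{(±n)}` get
  `BSD(·,2)` — a statement not printed anywhere (beyond-print: YES as an assembly of LLT24 / TYZ17 /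
  Tian14 / Monsky90 with Cassels' isogeny invariance; NO new arithmetic).

References: [cite: MilneADT2006, Thm. I.7.3]; [cite: Miller2011LMS, §1 and Def. 1.1];
[cite: LiLiuTian2024, Thm. 1.2]; [cite: TianYuanZhang2017, Thm. 1.1 and Thm. 1.3];
[cite: CremonaAlgorithms1997, §3.8 and Table 1 (class 32a)].
-/

set_option linter.dupNamespace false -- namespace `…BirchSwinnertonDyer.BirchSwinnertonDyer…` (D-0017 nested layout)
set_option autoImplicit false

noncomputable section

open scoped Classical

open WeierstrassCurve Literature.NumberTheory.EllipticCurves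
  Literature.NumberTheory.EllipticCurves.Rank1Residual
open Summit.BirchSwinnertonDyer.Rank1Residual

namespace Summit.BirchSwinnertonDyer.BirchSwinnertonDyer.Theorems.PrintCf2

open Summit.BirchSwinnertonDyer.BirchSwinnertonDyer.Theses.PrintCf2

/-- **The closed TYZ part of the ramified crux is isogeny-saturated.** Granted `𝔅_ram` and item
20508 (`hT`, closed in the tree by `ramifiedTYZFamiliesOfFacts_proof`): if a globally minimal `W` of
analytic rank one is `ℚ`-isogenous to a globally minimal member `W₀` of `CongruentTYZProvedFamily`,
then `BSD(W,2)`. [cite: MilneADT2006, Thm. I.7.3] [cite: Miller2011LMS, §1 and Def. 1.1] -/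
theorem bsdp_two_of_isIsogenous_tyzProved (hT : RamifiedTYZFamiliesOfFacts)
    (hB : rank_eq_analyticRank_of_analyticRank_le_one ∧ hasEntireLFunction_rat ∧
          bsdRHS_eq_of_isIsogenous ∧ bsdTriple_of_hasCM_of_L_one_ne_zero ∧
          TianYuanZhang2017.thm12_parity_of_scriptL' ∧ Tian2014.thm13_rank_one_and_sha_odd ∧
          Literature.NumberTheory.QuadraticFields.RedeiReichardt.redeiReichardt_fourTwoCard_classGroup ∧
          LiLiuTian2024.thm12_bsd_congruentNumberCurve ∧
          Monsky1990.cor515_rank_eq_one_and_card_selmerGroup_two ∧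
          HeathBrown1994.monsky_card_selmerGroup_two_even ∧ Tian2014.tian2014_system_sMinus_genus)
    {W W₀ : WeierstrassCurve ℚ} [W.IsElliptic] [W.IsGloballyMinimal] [W₀.IsElliptic]
    [W₀.IsGloballyMinimal] (hiso : IsIsogenous W W₀) (hF : CongruentTYZProvedFamily W₀)
    (hr : W.analyticRank = 1) : BSDp W 2 := by
  obtain ⟨hCM₀, hram₀⟩ := hasCM_and_cmRamified_two_of_congruentTYZProvedFamily hF
  have hr₀ : W₀.analyticRank = 1 := by rw [← analyticRank_eq_of_isIsogenous' hiso]; exact hr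
  have h₀ : BSDp W₀ 2 := hT hB W₀ hCM₀ hr₀ hram₀ hF
  exact Wuthrich2014.bsdp_of_isIsogenous hB.2.2.1 hiso (hB.1 W₀ hr₀.le).2
    (W₀.leadingLCoeff_ne_zero_holds (hB.2.1 W₀)) h₀

/-- **Isogeny-saturated form of the residual cut.** Granted `𝔅_ram` and item 20508: the residual
item 20509 (`RamifiedOffTYZOfFacts`) follows from `BSD(·,2)` on the globally minimal CM rank-one
curves with `2` ramified in `K` that are `ℚ`-isogenous to NO globally minimal member of
`CongruentTYZProvedFamily` — a strictly smaller class than «not a ℚ-model of a member» (it drops,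
for every proved `E_n`, the two `j = 287496` partners and the `j = 1728` partner `y² = x³ + 4n²x`).
[cite: MilneADT2006, Thm. I.7.3] [cite: CremonaAlgorithms1997, §3.8 and Table 1 (class 32a)] -/
theorem ramifiedOffTYZOfFacts_of_isogenySaturated (hT : RamifiedTYZFamiliesOfFacts)
    (h : (rank_eq_analyticRank_of_analyticRank_le_one ∧ hasEntireLFunction_rat ∧
          bsdRHS_eq_of_isIsogenous ∧ bsdTriple_of_hasCM_of_L_one_ne_zero ∧
          TianYuanZhang2017.thm12_parity_of_scriptL' ∧ Tian2014.thm13_rank_one_and_sha_odd ∧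
          Literature.NumberTheory.QuadraticFields.RedeiReichardt.redeiReichardt_fourTwoCard_classGroup ∧
          LiLiuTian2024.thm12_bsd_congruentNumberCurve ∧
          Monsky1990.cor515_rank_eq_one_and_card_selmerGroup_two ∧
          HeathBrown1994.monsky_card_selmerGroup_two_even ∧ Tian2014.tian2014_system_sMinus_genus) →
        ∀ (W : WeierstrassCurve ℚ) [W.IsElliptic] [W.IsGloballyMinimal],
          W.HasCM → W.analyticRank = 1 → CMRamified W 2 →
            (∀ (W₀ : WeierstrassCurve ℚ) [W₀.IsElliptic] [W₀.IsGloballyMinimal],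
              IsIsogenous W W₀ → ¬ CongruentTYZProvedFamily W₀) → BSDp W 2) :
    RamifiedOffTYZOfFacts := by
  intro hB W _ _ hCM hr hram _
  by_cases hex : ∃ (W₀ : WeierstrassCurve ℚ) (_ : W₀.IsElliptic) (_ : W₀.IsGloballyMinimal),
      IsIsogenous W W₀ ∧ CongruentTYZProvedFamily W₀
  · obtain ⟨W₀, _, _, hiso, hF⟩ := hex
    exact bsdp_two_of_isIsogenous_tyzProved hT hB hiso hF hr
  · exact h hB W hCM hr hram fun W₀ _ _ hiso hF ↦ hex ⟨W₀, ‹_›, ‹_›, hiso, hF⟩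

/-- **The congruent-partner instance.** Granted `𝔅_ram` and item 20508: a globally minimal `W` of
analytic rank one that is `ℚ`-isogenous to a congruent-number curve `E_n` (`n` squarefree) lying in
the proved families satisfies `BSD(W,2)` — the case of use being `j(W) = 287496`, where such an `n`
always exists (`exists_isIsogenous_congruentNumberCurve_of_j_eq_287496`, p542724). For instance `n ≡ 5 (mod 8)` with all prime factors `≡ 1 (mod 4)` and
no class of order `4` in `Cl(ℚ(√−n))` (Li–Liu–Tian 2024): both twists `[0,−6,0,1,0]^{(±n)}`.
[cite: LiLiuTian2024, Thm. 1.2] [cite: MilneADT2006, Thm. I.7.3] -/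
theorem bsdp_two_of_j287496_of_partner_tyzProved (hT : RamifiedTYZFamiliesOfFacts)
    (hB : rank_eq_analyticRank_of_analyticRank_le_one ∧ hasEntireLFunction_rat ∧
          bsdRHS_eq_of_isIsogenous ∧ bsdTriple_of_hasCM_of_L_one_ne_zero ∧
          TianYuanZhang2017.thm12_parity_of_scriptL' ∧ Tian2014.thm13_rank_one_and_sha_odd ∧
          Literature.NumberTheory.QuadraticFields.RedeiReichardt.redeiReichardt_fourTwoCard_classGroup ∧
          LiLiuTian2024.thm12_bsd_congruentNumberCurve ∧
          Monsky1990.cor515_rank_eq_one_and_card_selmerGroup_two ∧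
          HeathBrown1994.monsky_card_selmerGroup_two_even ∧ Tian2014.tian2014_system_sMinus_genus)
    (W : WeierstrassCurve ℚ) [W.IsElliptic] [W.IsGloballyMinimal] (hr : W.analyticRank = 1)
    {n : ℕ} (hsq : Squarefree n) (hiso : IsIsogenous W (congruentNumberCurve n))
    (hF : ∀ [(congruentNumberCurve n).IsElliptic] [(congruentNumberCurve n).IsGloballyMinimal],
      CongruentTYZProvedFamily (congruentNumberCurve n)) :
    BSDp W 2 := by
  haveI := isElliptic_congruentNumberCurve hsq.ne_zero
  haveI := isGloballyMinimal_congruentNumberCurve hsq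
  exact bsdp_two_of_isIsogenous_tyzProved hT hB hiso hF hr

end Summit.BirchSwinnertonDyer.BirchSwinnertonDyer.Theorems.PrintCf2

end
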